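import Mathlib
import HarnessLib
import Literature.Probability.MarkovChains.HeatKernelVarianceDecay

/-!
# The spectral-profile heat-kernel bound `d²_{2,π}(H_t(x,·),π) ≤ 4/V(t)`, `t = ∫_{4π_*}^{V(t)} dv/(vΛ(v))` (Goel–Montenegro–Tetali 2006, Theorem 2.1)

HONEST FRAMING: exact (Metropolis-corrected) sampling algorithms for lattice gauge theory; figures
of merit are autocorrelation/cost numbers at stated couplings and volumes; no continuum-physics claim.

Source (READ on the hub's materialised text): S. Goel, R. Montenegro, P. Tetali, *Mixing time
bounds via the spectral profile*, Electron. J. Probab. **11** (2006) 1–26 = math.PR/0505690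
[GoelMontenegroTetali2006], §1.1 eq. (var) and §2.1 THEOREM 2.1 with its proof.  Everything below
is PROVED (finite state space; 0 named facts).  Conventions (the tree's): `K = P` row-stochastic
with stationary positive probability vector `π`; `H_t = e^{−t(I−K)} = heatKernel P 1 t`, `𝓔(f,f) =
dirichletForm π P f`, `Var = lawVariance π`, `E = lawMean π`; the density of the chain started at
`x` is `u_{x,t}(y) = h(x,y,t) = H_t(x,y)/π(y) = heatKernelDensity P π t x y`, so `I_x(t) =
Var_π(u_{x,t}) = d²_{2,π}(H_t(x,·),π) = ‖h(x,·,t) − 1‖₂²`.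

THE PROFILE IS A PARAMETER.  The printed theorem is stated for the spectral profile `Λ` (Definition
1.5) and its proof uses exactly: (FK) LEMMA 2.1, `𝓔(u,u) ≥ ½Λ(4(Eu)²/Var u)·Var u` for non-constant
`u ≥ 0`; (M) `Λ` non-increasing; (P) `Λ ≥ λ₁ > 0` (what makes `∫ dv/(vΛ(v))` finite and the
division by `I_xΛ(4/I_x)` legitimate).  The theorems below are typed for ANY `Λ : ℝ → ℝ` with (FK),
(M), (P) on a ray `[a, ∞)`, `0 < a ≤ 4π(x)` (the printed lower limit is `a = 4π_*`); for `Λ =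
spectralProfile π P` (`SpectralProfile.lean`) these are `GoelMontenegroTetali2006_lemma_2_1`,
`spectralProfile_antitone`, `spectralGapR_le_spectralProfile` — TODO: that one-line specialisation
and THEOREM 1.1 are filed separately once those modules are built.  The inverse function `V(t)` is
not introduced: the conclusion is typed as the printed intermediate inequality `t ≤ ∫_a^{4/I_x(t)}
dv/(vΛ(v))` and in the form `∫_a^{4/ε} dv/(vΛ(v)) ≤ t ⇒ I_x(t) ≤ ε` (i.e. `I_x(t) ≤ 4/V(t)`).

## Content
* `GoelMontenegroTetali2006_thm_2_1_integration` — the calculus step AS PRINTED: `I > 0` of class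
  `C¹`, non-increasing on `[0,t]`, `I' ≤ −IΛ(4/I)` ⇒ **`t ≤ ∫_a^{4/I(t)} dv/(vΛ(v))`** (change of
  variables `v = 4/I(s)`, Mathlib's `integral_image_eq_integral_abs_deriv_smul`);
  `intervalIntegrable_inv_mul_profile`, `integral_inv_mul_profile_pos`.
* `heatKernelDensity` (`u_{x,t}`), `heatKernelDensity_nonneg`, `lawMean_heatKernelDensity` (`E u_{x,t}
  = 1`), `hasDerivAt_heatKernelDensity` (forward equation), **eq. (var)
  `hasDerivAt_lawVariance_heatKernelDensity`: `d/dt Var(u_{x,t}) = −2𝓔(u_{x,t},u_{x,t})`** (general,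
  not necessarily reversible, chain), `antitone_lawVariance_heatKernelDensity`,
  `lawVariance_heatKernelDensity_zero` (`I_x(0) = (1 − π(x))/π(x)`).
* **THEOREM 2.1** `GoelMontenegroTetali2006_thm_2_1_of_faberKrahn` (**`t ≤ ∫_a^{4/I_x(t)}
  dv/(vΛ(v))`**) and `GoelMontenegroTetali2006_thm_2_1` (**`∫_a^{4/ε} dv/(vΛ(v)) ≤ t ⇒
  d²_{2,π}(H_t(x,·),π) ≤ ε`**).

NOT HERE (scope, value-free): THEOREM 1.1 (the `L^∞` transfer through the adjoint heat kernel of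
`NashInequality.lean`), COROLLARY 2.1 (discrete time), the specialisation `Λ = spectralProfile`.
Context (cell pub-lqcd, venture LatticeQCDFlow; value-free): the integration engine that turns any
Faber–Krahn-type lower bound on `𝓔(u,u)/Var u`, `u ≥ 0`, into an `L²` convergence time.
-/

namespace Literature.Probability.MarkovChains

open Finset Matrix Set MeasureTheory intervalIntegral NormedSpace

variable {X : Type*} [Fintype X] [DecidableEq X] {P : Matrix X X ℝ} {π : X → ℝ}

/-! ## The calculus step: `I' ≤ −IΛ(4/I)` on `[0,t]` gives `t ≤ ∫_{a}^{4/I(t)} dv/(vΛ(v))` -/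

section Calculus

/-- **The integration step of the proof of THEOREM 2.1, as printed**: if `I > 0` is `C¹` and
non-increasing on `[0,t]` with `I'(s) ≤ −I(s)Λ(4/I(s))`, where `Λ ≥ m > 0` is non-increasing on
`[a, ∞)` and `a ≤ 4/I(0)`, then **`t ≤ ∫_a^{4/I(t)} dv/(vΛ(v))`** ("Integrating over `[0,t]` … With
the change of variable `v = 4/I`, `t ≤ ∫_{4/I(0)}^{4/I(t)} dv/(vΛ(v))`"; `≤ ∫_a^{4/I(t)}` as the
integrand is non-negative). [cite: GoelMontenegroTetali2006, §2.1 proof of Theorem 2.1] -/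
theorem GoelMontenegroTetali2006_thm_2_1_integration {I I' Λ : ℝ → ℝ} {a m t : ℝ}
    (ht : 0 ≤ t) (hI : ∀ s, HasDerivAt I (I' s) s) (hI'cont : Continuous I')
    (hIanti : AntitoneOn I (Icc 0 t)) (hIt : 0 < I t) (hm : 0 < m) (ha : 0 < a)
    (hΛm : ∀ v, a ≤ v → m ≤ Λ v) (hΛanti : AntitoneOn Λ (Ici a))
    (ha0 : a ≤ 4 / I 0)
    (hdiff : ∀ s ∈ Icc 0 t, I' s ≤ -(I s * Λ (4 / I s))) :
    t ≤ ∫ v in a..(4 / I t), (v * Λ v)⁻¹ := by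
  set L : ℝ → ℝ := fun v => Λ (max v a) with hL
  have hLanti : Antitone L := fun u v huv =>
    hΛanti (mem_Ici.2 (le_max_right u a)) (mem_Ici.2 (le_max_right v a)) (max_le_max huv le_rfl)
  have hLmeas : Measurable L := hLanti.measurable
  have hLeq : ∀ v, a ≤ v → L v = Λ v := fun v hv => by simp [hL, max_eq_left hv]
  have hLm : ∀ v, m ≤ L v := fun v => hΛm _ (le_max_right v a)
  set g : ℝ → ℝ := fun v => (v * L v)⁻¹ with hg
  have hIpos : ∀ s ∈ Icc (0:ℝ) t, 0 < I s := fun s hs => hIt.trans_le (hIanti hs (right_mem_Icc.2 ht) hs.2)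
  set φ : ℝ → ℝ := fun s => 4 / I s with hφ
  set φ' : ℝ → ℝ := fun s => -(4 * I' s) / I s ^ 2 with hφ'
  have hφderiv : ∀ s ∈ Icc (0:ℝ) t, HasDerivAt φ (φ' s) s := by
    intro s hs
    refine ((hasDerivAt_const s (4:ℝ)).div (hI s) (hIpos s hs).ne').congr_deriv ?_
    simp only [hφ']; ring
  have hφa : ∀ s ∈ Icc (0:ℝ) t, a ≤ φ s := by
    intro s hs
    exact ha0.trans (div_le_div_of_nonneg_left (by norm_num) (hIpos s hs) (hIanti (left_mem_Icc.2 ht) hs hs.1))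
  have hΛφ : ∀ s ∈ Icc (0:ℝ) t, 0 < Λ (φ s) := fun s hs => hm.trans_le (hΛm _ (hφa s hs))
  have hφ'pos : ∀ s ∈ Icc (0:ℝ) t, 0 < φ' s := by
    intro s hs
    have : I' s < 0 := by nlinarith [mul_pos (hIpos s hs) (hΛφ s hs), hdiff s hs]
    exact div_pos (by linarith) (pow_pos (hIpos s hs) 2)
  have hgφ : ∀ s ∈ Icc (0:ℝ) t, g (φ s) = I s / (4 * Λ (φ s)) := by
    intro s hs
    have hIs := hIpos s hs
    have hΛs0 := hΛφ s hs
    show (φ s * L (φ s))⁻¹ = I s / (4 * Λ (φ s))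
    rw [hLeq _ (hφa s hs), show φ s = 4 / I s from rfl, mul_inv, inv_div]
    field_simp
  have hpt : ∀ s ∈ Icc (0:ℝ) t, 1 ≤ |φ' s| * g (φ s) := by
    intro s hs
    have hd := hdiff s hs
    rw [abs_of_pos (hφ'pos s hs), hgφ s hs]
    simp only [hφ']
    rw [show -(4 * I' s) / I s ^ 2 * (I s / (4 * Λ (φ s))) = (-I' s) / (I s * Λ (φ s)) by
      field_simp]
    rw [one_le_div (mul_pos (hIpos s hs) (hΛφ s hs))]
    simpa [hφ] using by linarith [hd]
  have hφcont : ContinuousOn φ (Icc 0 t) := fun s hs => (hφderiv s hs).continuousAt.continuousWithinAt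
  have hφmono : StrictMonoOn φ (Icc 0 t) := by
    refine strictMonoOn_of_deriv_pos (convex_Icc 0 t) hφcont fun s hs => ?_
    rw [interior_Icc] at hs
    rw [(hφderiv s (Ioo_subset_Icc_self hs)).deriv]; exact hφ'pos s (Ioo_subset_Icc_self hs)
  have hφ0t : φ 0 ≤ φ t := hφmono.monotoneOn (left_mem_Icc.2 ht) (right_mem_Icc.2 ht) ht
  have himage : φ '' Icc 0 t = Icc (φ 0) (φ t) := by
    refine Subset.antisymm ?_ (intermediate_value_Icc ht hφcont)
    rintro _ ⟨s, hs, rfl⟩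
    exact ⟨hφmono.monotoneOn (left_mem_Icc.2 ht) hs hs.1, hφmono.monotoneOn hs (right_mem_Icc.2 ht) hs.2⟩
  have hcv : ∫ v in φ '' Icc 0 t, g v = ∫ s in Icc 0 t, |φ' s| • g (φ s) :=
    integral_image_eq_integral_abs_deriv_smul measurableSet_Icc
      (fun s hs => (hφderiv s hs).hasDerivWithinAt) hφmono.injOn g
  have hgmeas : Measurable g := (measurable_id.mul hLmeas).inv
  have hg0 : ∀ v, a ≤ v → 0 ≤ g v := fun v hv => inv_nonneg.2 (mul_nonneg (ha.le.trans hv) (hm.le.trans (hLm v)))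
  have hgle : ∀ v, a ≤ v → g v ≤ (a * m)⁻¹ := fun v hv => inv_anti₀ (mul_pos ha hm) (mul_le_mul hv (hLm v) hm.le (ha.le.trans hv))
  have hφt : a ≤ φ t := hφa t (right_mem_Icc.2 ht)
  have hgint : IntegrableOn g (Icc a (φ t)) := by
    refine Integrable.mono' (integrable_const ((a * m)⁻¹)) hgmeas.aestronglyMeasurable ?_
    filter_upwards [ae_restrict_mem measurableSet_Icc] with v hv
    rw [Real.norm_eq_abs, abs_of_nonneg (hg0 v hv.1)]; exact hgle v hv.1
  have hIcont : Continuous I := continuous_iff_continuousAt.2 fun s => (hI s).continuousAt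
  have hφ'cont : ContinuousOn φ' (Icc 0 t) :=
    ((continuous_const.mul hI'cont).neg).continuousOn.div ((hIcont.pow 2).continuousOn)
      (fun s hs => (pow_pos (hIpos s hs) 2).ne')
  obtain ⟨C, hC⟩ := isCompact_Icc.exists_bound_of_continuousOn hφ'cont
  have hint : IntegrableOn (fun s => |φ' s| • g (φ s)) (Icc 0 t) := by
    refine Integrable.mono' (integrable_const (C * (a * m)⁻¹)) ?_ ?_
    · exact ((continuous_abs.comp_continuousOn hφ'cont).aestronglyMeasurable measurableSet_Icc).smul
        (hgmeas.comp_aemeasurable (hφcont.aemeasurable measurableSet_Icc)).aestronglyMeasurable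
    · filter_upwards [ae_restrict_mem measurableSet_Icc] with s hs
      have h1 : |φ' s| ≤ C := by simpa [Real.norm_eq_abs] using hC s hs
      rw [Real.norm_eq_abs, smul_eq_mul, abs_of_nonneg (mul_nonneg (abs_nonneg _) (hg0 _ (hφa s hs)))]
      exact mul_le_mul h1 (hgle _ (hφa s hs)) (hg0 _ (hφa s hs)) ((abs_nonneg _).trans h1)
  -- assemble: `t = ∫_[0,t] 1 ≤ ∫_[0,t] |φ'| g(φ) = ∫_{φ 0}^{φ t} g ≤ ∫_a^{φ t} g`
  have hstep1 : t ≤ ∫ s in Icc 0 t, |φ' s| • g (φ s) := by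
    calc t = ∫ _ in Icc (0:ℝ) t, (1:ℝ) := by simp [ht]
      _ ≤ ∫ s in Icc 0 t, |φ' s| • g (φ s) :=
          setIntegral_mono_on (integrable_const _) hint measurableSet_Icc fun s hs => by rw [smul_eq_mul]; exact hpt s hs
  have hstep2 : ∫ s in Icc 0 t, |φ' s| • g (φ s) = ∫ v in (φ 0)..(φ t), g v := by
    rw [← hcv, himage, integral_Icc_eq_integral_Ioc, ← intervalIntegral.integral_of_le hφ0t]
  have hstep3 : ∫ v in (φ 0)..(φ t), g v ≤ ∫ v in a..(φ t), g v := by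
    have hi1 : IntervalIntegrable g volume a (φ 0) :=
      (hgint.mono_set (by rw [uIcc_of_le ha0]; exact Icc_subset_Icc_right hφ0t)).intervalIntegrable
    have hi2 : IntervalIntegrable g volume (φ 0) (φ t) :=
      (hgint.mono_set (by rw [uIcc_of_le hφ0t]; exact Icc_subset_Icc_left ha0)).intervalIntegrable
    rw [← integral_add_adjacent_intervals hi1 hi2]
    linarith [intervalIntegral.integral_nonneg (μ := volume) ha0 fun v hv => hg0 v hv.1]
  have hstep4 : ∫ v in a..(φ t), g v = ∫ v in a..(4 / I t), (v * Λ v)⁻¹ := by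
    refine intervalIntegral.integral_congr fun v hv => ?_
    rw [uIcc_of_le hφt] at hv
    show (v * L v)⁻¹ = (v * Λ v)⁻¹; rw [hLeq v hv.1]
  linarith [hstep1, hstep2, hstep3, hstep4]

/-- The integrand `1/(vΛ(v))` of THEOREM 2.1 is integrable on every `[c,d] ⊂ [a,∞)`.
[cite: GoelMontenegroTetali2006, §2.1 (the integral `∫ dv/(vΛ(v))` defining `V(t)`)] -/
theorem intervalIntegrable_inv_mul_profile {Λ : ℝ → ℝ} {a m c d : ℝ} (ha : 0 < a) (hm : 0 < m)
    (hΛm : ∀ v, a ≤ v → m ≤ Λ v) (hΛanti : AntitoneOn Λ (Ici a)) (hc : a ≤ c) (hcd : c ≤ d) :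
    IntervalIntegrable (fun v => (v * Λ v)⁻¹) volume c d := by
  set L : ℝ → ℝ := fun v => Λ (max v a) with hL
  have hLanti : Antitone L := fun u v huv =>
    hΛanti (mem_Ici.2 (le_max_right u a)) (mem_Ici.2 (le_max_right v a)) (max_le_max huv le_rfl)
  have hLeq : ∀ v, a ≤ v → L v = Λ v := fun v hv => by simp [hL, max_eq_left hv]
  have hLm : ∀ v, m ≤ L v := fun v => hΛm _ (le_max_right v a)
  have hgmeas : Measurable (fun v => (v * L v)⁻¹) := (measurable_id.mul hLanti.measurable).inv
  have hgint : IntegrableOn (fun v => (v * L v)⁻¹) (Icc c d) := by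
    refine Integrable.mono' (integrable_const ((a * m)⁻¹)) hgmeas.aestronglyMeasurable ?_
    filter_upwards [ae_restrict_mem measurableSet_Icc] with v hv
    have hav : a ≤ v := hc.trans hv.1
    rw [Real.norm_eq_abs, abs_of_nonneg (inv_nonneg.2 (mul_nonneg (ha.le.trans hav) (hm.le.trans (hLm v))))]
    exact inv_anti₀ (mul_pos ha hm) (mul_le_mul hav (hLm v) hm.le (ha.le.trans hav))
  have hgint' : IntegrableOn (fun v => (v * Λ v)⁻¹) (Icc c d) :=
    hgint.congr_fun (fun v hv => by show (v * L v)⁻¹ = (v * Λ v)⁻¹; rw [hLeq v (hc.trans hv.1)])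
      measurableSet_Icc
  exact (hgint'.mono_set (by rw [uIcc_of_le hcd])).intervalIntegrable

/-- `∫_c^d dv/(vΛ(v)) > 0` for `a ≤ c < d` (integrand `≥ 1/(dΛ(a)) > 0`): the integral of THEOREM
2.1 is strictly increasing in its upper limit, which is what makes the source's `V(t)` well defined.
[cite: GoelMontenegroTetali2006, §2.1 ("`V(t)` is well-defined for `t ≥ 0`")] -/
theorem integral_inv_mul_profile_pos {Λ : ℝ → ℝ} {a m c d : ℝ} (ha : 0 < a) (hm : 0 < m)
    (hΛm : ∀ v, a ≤ v → m ≤ Λ v) (hΛanti : AntitoneOn Λ (Ici a)) (hc : a ≤ c) (hcd : c < d) :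
    0 < ∫ v in c..d, (v * Λ v)⁻¹ := by
  have hd : a ≤ d := hc.trans hcd.le
  have hd0 : 0 < d := ha.trans_le hd
  have hΛa : 0 < Λ a := hm.trans_le (hΛm a le_rfl)
  have hκ : 0 < (d * Λ a)⁻¹ := inv_pos.2 (mul_pos hd0 hΛa)
  have hle : ∀ v ∈ Icc c d, (d * Λ a)⁻¹ ≤ (v * Λ v)⁻¹ := by
    intro v hv
    have hav : a ≤ v := hc.trans hv.1
    have hΛv : 0 < Λ v := hm.trans_le (hΛm v hav)
    exact inv_anti₀ (mul_pos (ha.trans_le hav) hΛv)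
      (mul_le_mul hv.2 (hΛanti (mem_Ici.2 le_rfl) (mem_Ici.2 hav) hav) hΛv.le hd0.le)
  have hmono := intervalIntegral.integral_mono_on hcd.le intervalIntegrable_const
    (intervalIntegrable_inv_mul_profile ha hm hΛm hΛanti hc hcd.le) hle
  rw [intervalIntegral.integral_const, smul_eq_mul] at hmono
  exact lt_of_lt_of_le (mul_pos (by linarith) hκ) hmono

end Calculus

/-! ## The density `u_{x,t} = h(x,·,t)` and eq. (var) -/

section Density

/-- The density at time `t` of the chain started at `x`: `u_{x,t}(y) = h(x,y,t) = H_t(x,y)/π(y)`.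
[cite: GoelMontenegroTetali2006, §1.1 ("`h(x,y,t) = H_t(x,y)/π(y)`"); §2.1 proof of Theorem 2.1] -/
noncomputable def heatKernelDensity (P : Matrix X X ℝ) (π : X → ℝ) (t : ℝ) (x : X) : X → ℝ :=
  fun y => heatKernel P 1 t x y / π y

/-- `u_{x,t} ≥ 0` (`t ≥ 0`). [cite: GoelMontenegroTetali2006, §2.1 proof of Theorem 2.1] -/
theorem heatKernelDensity_nonneg (hP : IsRowStochastic P) (hπ : ∀ y, 0 < π y) {t : ℝ} (ht : 0 ≤ t)
    (x y : X) : 0 ≤ heatKernelDensity P π t x y :=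
  div_nonneg (heatKernel_nonneg hP (by simpa using ht) x y) (hπ y).le

/-- `E_π u_{x,t} = Σ_y H_t(x,y) = 1`. [cite: GoelMontenegroTetali2006, §2.1 proof of Theorem 2.1] -/
theorem lawMean_heatKernelDensity (hP : IsRowStochastic P) (hπ : ∀ y, 0 < π y) (t : ℝ) (x : X) :
    lawMean π (heatKernelDensity P π t x) = 1 := by
  unfold lawMean heatKernelDensity
  refine Eq.trans (sum_congr rfl fun y _ => ?_) (sum_heatKernel hP 1 t x)
  exact mul_div_cancel₀ _ (hπ y).ne'

/-- `u_{x,0} = 1_x/π(x)` (`H_0 = I`). [cite: GoelMontenegroTetali2006, §2.1 proof of Theorem 2.1] -/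
theorem heatKernelDensity_zero (P : Matrix X X ℝ) (π : X → ℝ) (x : X) :
    heatKernelDensity P π 0 x = fun y => if y = x then (π x)⁻¹ else 0 := by
  funext y
  unfold heatKernelDensity heatKernel
  rw [zero_smul, NormedSpace.exp_zero, Matrix.one_apply]
  by_cases h : y = x
  · subst h; simp
  · rw [if_neg (Ne.symm h), if_neg h, zero_div]

/-- The forward equation for the density: `d/dt u_{x,t}(y) = (H_t(K − I))(x,y)/π(y)`.
[cite: GoelMontenegroTetali2006, §1.1 ("`H_t = e^{−tΔ}`, `Δ = I − K`")] -/
theorem hasDerivAt_heatKernelDensity (P : Matrix X X ℝ) (π : X → ℝ) (t : ℝ) (x y : X) :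
    HasDerivAt (fun s : ℝ => heatKernelDensity P π s x y)
      ((heatKernel P 1 t * rateGenerator P 1) x y / π y) t :=
  (hasDerivAt_apply_of_hasDerivAt (Norris1997_thm_2_1_1_forward (rateGenerator P 1) t) x y).div_const (π y)

/-- `t ↦ u_{x,t}(y)` is continuous. [cite: GoelMontenegroTetali2006, §1.1] -/
theorem continuous_heatKernelDensity (P : Matrix X X ℝ) (π : X → ℝ) (x y : X) :
    Continuous fun s : ℝ => heatKernelDensity P π s x y :=
  continuous_iff_continuousAt.2 fun s => (hasDerivAt_heatKernelDensity P π s x y).continuousAt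

/-- `t ↦ 𝓔(u_{x,t},u_{x,t})` is continuous. [cite: GoelMontenegroTetali2006, §2.1 proof of Theorem 2.1] -/
theorem continuous_dirichletForm_heatKernelDensity (P : Matrix X X ℝ) (π : X → ℝ) (x : X) :
    Continuous fun s : ℝ => dirichletForm π P (heatKernelDensity P π s x) := by
  have hc := continuous_heatKernelDensity P π x
  unfold dirichletForm
  refine continuous_const.mul (continuous_finsetSum _ fun a _ => continuous_finsetSum _ fun b _ => ?_)
  exact continuous_const.mul (((hc a).sub (hc b)).pow 2)

/-- **Eq. (var) for a general finite chain: `d/dt Var(u_{x,t}) = −2𝓔(u_{x,t},u_{x,t})`** (`π`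
stationary and positive; typed from the forward equation `d/dt H_t = H_t(K − I)`, `H_t(x,z) =
π(z)u_{x,t}(z)` and `𝓔(u,u) = ‖u‖₂² − ⟨u,Ku⟩_π`; no reversibility — the density evolves under the
adjoint chain, whose Dirichlet form is the same). [cite: GoelMontenegroTetali2006, §1.1 eq. (var);
§2.1 proof of Theorem 2.1 ("`I_x'(t) = −2𝓔(u_{x,t},u_{x,t})`")] -/
theorem hasDerivAt_lawVariance_heatKernelDensity (hP : IsRowStochastic P) (hst : IsStationary π P)
    (hπ : ∀ y, 0 < π y) (hπ1 : ∑ y, π y = 1) (t : ℝ) (x : X) :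
    HasDerivAt (fun s : ℝ => lawVariance π (heatKernelDensity P π s x))
      (-(2 * dirichletForm π P (heatKernelDensity P π t x))) t := by
  set u : ℝ → X → ℝ := fun s => heatKernelDensity P π s x with hu
  set M := heatKernel P 1 t with hM
  have hvar : (fun s : ℝ => lawVariance π (u s)) = fun s => piInner π (u s) (u s) - 1 := by
    funext s
    have h := piInner_sub_const_eq hπ1 (u s) 0
    simp only [sub_zero] at h; rw [h, lawMean_heatKernelDensity hP hπ s x]; ring
  have hsum : HasDerivAt (fun s : ℝ => piInner π (u s) (u s))
      (∑ y, π y * ((M * rateGenerator P 1) x y / π y * u t y + u t y * ((M * rateGenerator P 1) x y / π y))) t := by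
    show HasDerivAt (fun s : ℝ => ∑ y, π y * (u s y * u s y)) _ t
    exact HasDerivAt.fun_sum fun y _ =>
      ((hasDerivAt_heatKernelDensity P π t x y).mul (hasDerivAt_heatKernelDensity P π t x y)).const_mul _
  have hMu : ∀ z, M x z = π z * u t z := fun z => by
    simp only [hu, heatKernelDensity, hM]; rw [mul_div_cancel₀ _ (hπ z).ne']
  have hrow : ∀ y, (M * rateGenerator P 1) x y = ∑ z, π z * u t z * P z y - π y * u t y := by
    intro y
    rw [rateGenerator, one_smul, Matrix.mul_sub, Matrix.mul_one, Matrix.sub_apply, Matrix.mul_apply, hMu y]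
    exact congrArg₂ (· - ·) (sum_congr rfl fun z _ => by rw [hMu z]) rfl
  have e : ∑ y, π y * ((M * rateGenerator P 1) x y / π y * u t y + u t y * ((M * rateGenerator P 1) x y / π y)) =
      -(2 * dirichletForm π P (u t)) := by
    rw [dirichletForm_eq hP hst (u t)]
    have e1 : ∀ y, π y * ((M * rateGenerator P 1) x y / π y * u t y + u t y * ((M * rateGenerator P 1) x y / π y)) =
        2 * (u t y * ∑ z, π z * u t z * P z y) - 2 * (π y * (u t y * u t y)) := by
      intro y
      have hπy : π y ≠ 0 := (hπ y).ne'
      rw [hrow y]; field_simp; ring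
    simp only [e1, sum_sub_distrib, ← mul_sum, piInner, mulVec, dotProduct]
    have e2 : ∑ y, u t y * ∑ z, π z * u t z * P z y = ∑ z, π z * (u t z * ∑ y, P z y * u t y) := by
      simp only [mul_sum]; rw [sum_comm]; exact sum_congr rfl fun z _ => sum_congr rfl fun y _ => by ring
    rw [e2]; ring
  rw [hvar, ← e]; exact hsum.sub_const 1

/-- `t ↦ I_x(t) = Var(u_{x,t})` is non-increasing (`I_x' = −2𝓔 ≤ 0`).
[cite: GoelMontenegroTetali2006, §2.1 proof of Theorem 2.1] -/
theorem antitone_lawVariance_heatKernelDensity (hP : IsRowStochastic P) (hst : IsStationary π P)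
    (hπ : ∀ y, 0 < π y) (hπ1 : ∑ y, π y = 1) (x : X) :
    Antitone fun s : ℝ => lawVariance π (heatKernelDensity P π s x) := by
  have hd := fun s => hasDerivAt_lawVariance_heatKernelDensity hP hst hπ hπ1 s x
  refine antitone_of_deriv_nonpos (fun s => (hd s).differentiableAt) fun s => ?_
  rw [(hd s).deriv]
  linarith [dirichletForm_nonneg (fun y => (hπ y).le) hP.1 (heatKernelDensity P π s x)]

/-- `I_x(0) = Var(1_x/π(x)) = (1 − π(x))/π(x) = 1/π(x) − 1`. [cite: GoelMontenegroTetali2006, §2.1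
proof of Theorem 2.1 ("`I_x(0) = 1/π(y) − 1 < 1/π_*`")] -/
theorem lawVariance_heatKernelDensity_zero (hπ : ∀ y, 0 < π y) (hπ1 : ∑ y, π y = 1) (x : X) :
    lawVariance π (heatKernelDensity P π 0 x) = (1 - π x) / π x := by
  rw [heatKernelDensity_zero, lawVariance_indicator hπ hπ1 x]

end Density

/-! ## THEOREM 2.1 -/

section TheoremTwoOne

/-- **THEOREM 2.1 (Goel–Montenegro–Tetali 2006), the integrated differential inequality.**  `K`
row-stochastic with stationary positive probability vector `π`; `Λ : ℝ → ℝ` with, on a ray `[a, ∞)`,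
`0 < a ≤ 4π(x)`: (FK) `𝓔(u,u) ≥ ½Λ(4(Eu)²/Var u)·Var u` for non-constant `u ≥ 0` (LEMMA 2.1 for
the spectral profile), (M) non-increasing, (P) `Λ ≥ m > 0`.  Then for `t ≥ 0` with `I_x(t) =
Var_π(u_{x,t}) > 0`: **`t ≤ ∫_a^{4/I_x(t)} dv/(vΛ(v))`** (`4/I_x(0) = 4π(x)/(1 − π(x)) ≥ a`).
[cite: GoelMontenegroTetali2006, §2.1 Theorem 2.1 (statement and proof)] -/
theorem GoelMontenegroTetali2006_thm_2_1_of_faberKrahn (hπ : ∀ y, 0 < π y) (hπ1 : ∑ y, π y = 1)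
    (hP : IsRowStochastic P) (hst : IsStationary π P) {Λ : ℝ → ℝ} {a m : ℝ} (ha : 0 < a)
    (hm : 0 < m) (hΛm : ∀ v, a ≤ v → m ≤ Λ v) (hΛanti : AntitoneOn Λ (Ici a))
    (hFK : ∀ u : X → ℝ, (∀ y, 0 ≤ u y) → 0 < lawVariance π u →
      (1 / 2) * Λ (4 * lawMean π u ^ 2 / lawVariance π u) * lawVariance π u ≤ dirichletForm π P u)
    {x : X} (hax : a ≤ 4 * π x) {t : ℝ} (ht : 0 ≤ t)
    (hIt : 0 < lawVariance π (heatKernelDensity P π t x)) :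
    t ≤ ∫ v in a..(4 / lawVariance π (heatKernelDensity P π t x)), (v * Λ v)⁻¹ := by
  set I : ℝ → ℝ := fun s => lawVariance π (heatKernelDensity P π s x) with hI
  have hId := fun s => hasDerivAt_lawVariance_heatKernelDensity hP hst hπ hπ1 s x
  have hIanti : Antitone I := antitone_lawVariance_heatKernelDensity hP hst hπ hπ1 x
  -- `a ≤ 4π(x) ≤ 4π(x)/(1 − π(x)) = 4/I(0)`
  have hI0 : I 0 = (1 - π x) / π x := lawVariance_heatKernelDensity_zero hπ hπ1 x
  have hI0pos : 0 < I 0 := hIt.trans_le (hIanti ht)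
  have h1πx : 0 < 1 - π x := by
    have h := hI0pos; rw [hI0] at h
    exact (div_pos_iff_of_pos_right (hπ x)).1 h
  have ha0 : a ≤ 4 / I 0 := by
    rw [hI0, div_div_eq_mul_div, le_div_iff₀ h1πx]
    nlinarith [hπ x, ha]
  refine GoelMontenegroTetali2006_thm_2_1_integration ht hId
    ((continuous_const.mul (continuous_dirichletForm_heatKernelDensity P π x)).neg)
    (hIanti.antitoneOn _) hIt hm ha hΛm hΛanti ha0 fun s hs => ?_
  -- the differential inequality on `[0,t]`: Lemma 2.1 (= (FK)) applied to `u_{x,s} ≥ 0`, `E u_{x,s} = 1`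
  have hIs : 0 < I s := hIt.trans_le (hIanti hs.2)
  have h := hFK _ (heatKernelDensity_nonneg hP hπ hs.1 x) hIs
  rw [lawMean_heatKernelDensity hP hπ s x, one_pow, mul_one] at h
  show -(2 * dirichletForm π P (heatKernelDensity P π s x)) ≤ -(I s * Λ (4 / I s))
  linarith [h]

/-- **THEOREM 2.1 (Goel–Montenegro–Tetali 2006): `d²_{2,π}(H_t(x,·),π) ≤ 4/V(t)`, `t =
∫_{4π_*}^{V(t)} dv/(vΛ(v))`**, typed without the inverse function `V`: under (FK), (M), (P) on
`[a, ∞)`, `0 < a ≤ 4π(x)` (the printed `a = 4π_*`), for `ε > 0`, `t ≥ 0`: **`∫_a^{4/ε} dv/(vΛ(v)) ≤ t`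
implies `‖h(x,·,t) − 1‖₂² ≤ ε`**. [cite: GoelMontenegroTetali2006, §2.1 Theorem 2.1] -/
theorem GoelMontenegroTetali2006_thm_2_1 (hπ : ∀ y, 0 < π y) (hπ1 : ∑ y, π y = 1)
    (hP : IsRowStochastic P) (hst : IsStationary π P) {Λ : ℝ → ℝ} {a m : ℝ} (ha : 0 < a)
    (hm : 0 < m) (hΛm : ∀ v, a ≤ v → m ≤ Λ v) (hΛanti : AntitoneOn Λ (Ici a))
    (hFK : ∀ u : X → ℝ, (∀ y, 0 ≤ u y) → 0 < lawVariance π u →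
      (1 / 2) * Λ (4 * lawMean π u ^ 2 / lawVariance π u) * lawVariance π u ≤ dirichletForm π P u)
    {x : X} (hax : a ≤ 4 * π x) {t ε : ℝ} (ht : 0 ≤ t) (hε : 0 < ε)
    (hint : ∫ v in a..(4 / ε), (v * Λ v)⁻¹ ≤ t) :
    lawVariance π (heatKernelDensity P π t x) ≤ ε := by
  by_contra hcon
  rw [not_le] at hcon
  set It := lawVariance π (heatKernelDensity P π t x) with hItdef
  have hIt : 0 < It := hε.trans hcon
  have hmain := GoelMontenegroTetali2006_thm_2_1_of_faberKrahn hπ hπ1 hP hst ha hm hΛm hΛanti hFK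
    hax ht hIt
  -- `a ≤ 4/I(t) < 4/ε`, so `∫_a^{4/ε} = ∫_a^{4/I(t)} + ∫_{4/I(t)}^{4/ε} > ∫_a^{4/I(t)} ≥ t`
  have hIanti := antitone_lawVariance_heatKernelDensity hP hst hπ hπ1 x (P := P)
  have hI0 := lawVariance_heatKernelDensity_zero hπ hπ1 x (P := P)
  have hle0 : It ≤ (1 - π x) / π x := by rw [← hI0]; exact hIanti ht
  have haI : a ≤ 4 / It := by
    refine hax.trans ?_
    rw [le_div_iff₀ hIt]
    have : It * π x ≤ 1 - π x := by
      have h := mul_le_mul_of_nonneg_right hle0 (hπ x).le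
      rwa [div_mul_cancel₀ _ (hπ x).ne'] at h
    nlinarith [hπ x]
  have hlt : 4 / It < 4 / ε := div_lt_div_of_pos_left (by norm_num) hε hcon
  have hpos := integral_inv_mul_profile_pos ha hm hΛm hΛanti haI hlt
  have hsplit := intervalIntegral.integral_add_adjacent_intervals
    (intervalIntegrable_inv_mul_profile ha hm hΛm hΛanti le_rfl haI)
    (intervalIntegrable_inv_mul_profile ha hm hΛm hΛanti haI hlt.le)
  linarith

end TheoremTwoOne

end Literature.Probability.MarkovChains
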